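/-
COR-CM (cell pub-hodgecm2, stage 2 of the Hodge ladder) — Δ2 BRIDGE, the μ ↦ μᶜ ADAPTER: the [Def 4.11] LEG `h411C` OF
✔ `AdapterMuConj.thm418C_liuDictionaryPin_of_muConj` WITHOUT THE DISPLAYED `h411` — from [Lem D.1 (1)] per place (irreducible),
smoothness BY VALUE, and [Thm 4.18] AS PRINTED at the CONJUGATE rests (`hLiuC`, admissible: ✔ `Liu2021/AppendixC/Thm418SummandsAdmissible`).
Seat prover-pub-hodgecm2-item6-p3-g15-0 (item6-p3 gen 15, X3-ω ∕ item-(vi) lineage), 2026-08-24.  NEW additive leaf; theorems only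
(kernel lane); nothing landed is edited or restated; count-neutral; HC_CM is NOT proved; «Δ2 BRIDGE CLOSED» is NOT claimed.
-/
import Summits.HodgeConjecture.CorCM.D2Bridge.AdapterMuConjLegs
import Summits.HodgeConjecture.CorCM.B01.Transposition.Item6UniformOmegaRep
import Literature.NumberTheory.Automorphic.Liu2021.AppendixC.Thm418SummandsAdmissible
import Literature.NumberTheory.Automorphic.Liu2021.Def411AsPrinted
import HarnessLib

set_option autoImplicit false

/-!
# The μ ↦ μᶜ adapter: the Def-4.11 leg at `muConj U` from Lem D.1 (1) + smoothness + Thm 4.18 as printed at the conjugate rests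

[Liu2021] Y. Liu, *Fourier–Jacobi cycles and arithmetic relative trace formula*, Camb. J. Math. **9** (2021) = arXiv:2102.11518.

✔ `AdapterMuConjLegs.def411_muConj` fills the binder `h411C` of the adapter assembly from the END's DISPLAYED `h411` ([Def. 4.11] AS PRINTED at
the un-relabelled rests, all three adjectives, all `(ε, χ)`).  Here the same binder is filled WITHOUT `h411`:

* `def411_of_thm418AsPrinted` (§1, any `U : UniformOmega C`, any tails) — the Def-4.11 adjectives at every admissible triple of
  `U.prop413Data H` from: irreducible-or-zero and smooth summands at every admissible INDEX of the rests `U.rest (tail μ hμ hw)` (at the model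
  these are THEOREMS: [Lem. D.1 (1)] per place + survival, resp. `rho_smooth`), an object of `𝒜(μ)` (from [Shimura1998, Thm. 21.4]) and
  [Thm. 4.18] AS PRINTED at those rests (admissibility = ✔ `AppendixC.isAdmissibleRep_rhoAt_toThm418Data_of_thm418AsPrinted`, Mumford §19 Thm. 3);
* `Model.isAdmissibleRep_rhoAt_restOfCharRep_of_thm418AsPrinted`, `Model.adjectives_rhoAt_uniformOmegaRep_of_lemD1AsPrinted_of_thm418AsPrinted`
  (§1b, the model's `Model.uniformOmegaRep … δ′ r`, namespace `Summit.HodgeConjecture.CorCM.Model`) — the LIVE END's `h411` slot from {`hD1`, `hLiu`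
  (same-`μ` Thm 4.18 at the rests `restOfCharRep … δ′ (r μ hμ) μ hμ hw`), `h21`}; companion of ✔ `Transposition/Item6UniformOmegaRepAdjectivesOfLemD1.lean`
  (which takes admissibility as a binder);
* `def411_muConj_of_thm418AsPrintedC` (§2) — the same at `muConj U`: irreducible ∕ smooth transfer from `U` at `νᶜ` (same carrier, `rfl`,
  ✔ `conjTriple_mem`), admissibility from [Thm. 4.18] AS PRINTED at the CONJUGATE rests `(muConj U).rest (tailC ν hν hw)` — the adapter END's
  displayed `hLiuC` — and an object of `𝒜(ν)`; NO same-`μ` Thm-4.18 family and NO `h411` is used;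
* `def411_muConj_uniformOmegaRep_of_lemD1AsPrinted_of_thm418AsPrintedC` (§3, the model's μ-uniform carriers `Model.uniformOmegaRep … δ′ r`,
  `ιV` continuous and onto, `3 ≤ n`) — binders: `hD1` ([Lem. D.1, first sentence + (1)] AS PRINTED per place at the `μ`-attached local data, every
  `μ`, unguarded), `hLiuC` ([Thm. 4.18] AS PRINTED at the conjugate rests with the one-object tails `restTailOne …`), `h21` ([Shimura1998, Thm. 21.4]).

So an END over the adapter that displays `hLiuC`, `h21` and the per-place Lem-D.1 family (unguarded in `μ`) need not display `h411`.
Nothing of [Liu2021] ∕ [Shimura1998] is asserted: all cited sentences are hypotheses.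

## References
* [Liu2021] Def. 4.11–4.12 (FJcycle.tex ll. 2083–2111), Rem. 4.4 (ll. 1912–1933), Prop. 4.6 (1) (l. 1969), Thm. 4.18 (ll. 2232–2245),
  App. D Lem. D.1 (ll. 5226–5233).
* [Shimura1998] G. Shimura, *Abelian varieties with complex multiplication and modular functions* (1998), §21.4 Thm. 21.4.
* [MumfordAV1970] D. Mumford, *Abelian Varieties* (1970), §19 Thm. 3.
* Tree: `CorCM/D2Bridge/AdapterMuConj{,Legs}.lean` (`muConj`, `conjTriple_mem`, `def411_muConj`), `Liu2021/AppendixC/Thm418SummandsAdmissible.lean`,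
  `Transposition/Item6UniformOmegaRep.lean` + `Item6RestOfCharRep.lean` (`uniformOmegaRep`, `rhoAt_restOfCharRep_smooth`,
  `rhoAt_restOfCharRep_isIrreducible_of_lemD1AsPrinted`, `nonempty_obj_restOfCharRep`).
-/

noncomputable section

namespace Summit.HodgeConjecture.CorCM.D2Bridge.AdapterMuConj

open NumberField IsDedekindDomain
open Literature.NumberTheory.Automorphic Literature.NumberTheory.Automorphic.IdeleClassGroup
open Literature.NumberTheory.Automorphic.Liu2021 Literature.NumberTheory.Automorphic.Liu2021.AppendixC
open Literature.RepresentationTheory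

section Generic

/- As in `AdapterMuConjLegs.lean`: every structure ∕ class parameter of the App-C context is IMPLICIT, the CM-field instance on `E` is
AppendixC's `isCMField F E` (`letI`). -/
variable {F E : Type} {iF₁ : Field F} {iF₂ : NumberField F} {iF₃ : IsTotallyReal F} {iE₁ : Field E} {iE₂ : NumberField E}
  {iA : Algebra F E} {iE₃ : IsTotallyComplex E} {iQ : Algebra.IsQuadraticExtension F E}
variable {P5 : PropC5Data F E} {isotropicAt : ℕ → Prop} {C : Sec42Data P5 isotropicAt}
variable (U : UniformOmega C) (H : Type) [AddCommGroup H] [Module ℂ H] [Module (MonoidAlgebra ℂ C.G) H]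
  [IsScalarTower ℂ (MonoidAlgebra ℂ C.G) H]

/-- **§1 The Def-4.11 leg at `U` WITHOUT Def. 4.11**: for every conjugate-symplectic weight-one `μ` and every admissible index `j` of the rest
`U.rest (tail μ hμ hw)`, irreducible-or-zero (`hirr`) and smooth (`hsm`) summands, an object `D_μ ∈ 𝒜(μ)` (`hObj`) and [Liu2021, Thm. 4.18] AS
PRINTED at that rest (`hLiu`) ⟹ every summand of `U.prop413Data H` is irreducible-or-zero, smooth and ADMISSIBLE (the binder `h411` of the
Prop-4.13 pay-off ∕ of `PinSignatures.thm418C_liuDictionaryPin_of_pins`); admissibility is ✔ `AppendixC.isAdmissibleRep_rhoAt_toThm418Data_of_thm418AsPrinted`.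
[cite: Liu2021, Def. 4.11 (FJcycle.tex ll. 2092–2096), Thm. 4.18 (ll. 2232–2245), Prop. 4.6 (1) (l. 1969)] -/
theorem def411_of_thm418AsPrinted
    (tail : ∀ (μ : Literature.NumberTheory.Automorphic.IdeleClassGroup E →ₜ* Circle)
      (hμ : letI : IsCMField E := isCMField F E; IdeleClassGroup.IsConjugateSymplectic E μ),
      (letI : IsCMField E := isCMField F E; IdeleClassGroup.HasWeight E μ 1) → RestTail C μ hμ)
    (hirr : ∀ (μ : Literature.NumberTheory.Automorphic.IdeleClassGroup E →ₜ* Circle)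
      (hμ : letI : IsCMField E := isCMField F E; IdeleClassGroup.IsConjugateSymplectic E μ)
      (hw : letI : IsCMField E := isCMField F E; IdeleClassGroup.HasWeight E μ 1)
      (j : (toThm418Data C (U.rest (tail μ hμ hw))).AdmIndex), IsIrreducibleOrZero ((toThm418Data C (U.rest (tail μ hμ hw))).rhoAt j))
    (hsm : ∀ (μ : Literature.NumberTheory.Automorphic.IdeleClassGroup E →ₜ* Circle)
      (hμ : letI : IsCMField E := isCMField F E; IdeleClassGroup.IsConjugateSymplectic E μ)
      (hw : letI : IsCMField E := isCMField F E; IdeleClassGroup.HasWeight E μ 1)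
      (j : (toThm418Data C (U.rest (tail μ hμ hw))).AdmIndex), IsSmoothRep ((toThm418Data C (U.rest (tail μ hμ hw))).rhoAt j))
    (hObj : ∀ (μ : Literature.NumberTheory.Automorphic.IdeleClassGroup E →ₜ* Circle)
      (hμ : letI : IsCMField E := isCMField F E; IdeleClassGroup.IsConjugateSymplectic E μ)
      (hw : letI : IsCMField E := isCMField F E; IdeleClassGroup.HasWeight E μ 1), Nonempty (toThm418Data C (U.rest (tail μ hμ hw))).Obj)
    (hLiu : ∀ (μ : Literature.NumberTheory.Automorphic.IdeleClassGroup E →ₜ* Circle)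
      (hμ : letI : IsCMField E := isCMField F E; IdeleClassGroup.IsConjugateSymplectic E μ)
      (hw : letI : IsCMField E := isCMField F E; IdeleClassGroup.HasWeight E μ 1), Thm418AsPrinted (toThm418Data C (U.rest (tail μ hμ hw))))
    (t : (U.prop413Data H).AdmTriple) :
    IsIrreducibleOrZero ((U.prop413Data H).rhoAt t) ∧ IsSmoothRep ((U.prop413Data H).rhoAt t) ∧ IsAdmissibleRep ((U.prop413Data H).rhoAt t) := by
  obtain ⟨D⟩ := hObj t.1.μ t.1.isConjugateSymplectic t.2.1
  exact ⟨hirr t.1.μ t.1.isConjugateSymplectic t.2.1 ⟨(t.1.ε, t.1.χ), t.2.2⟩, hsm t.1.μ t.1.isConjugateSymplectic t.2.1 ⟨(t.1.ε, t.1.χ), t.2.2⟩,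
    AppendixC.isAdmissibleRep_rhoAt_toThm418Data_of_thm418AsPrinted C (U.rest (tail t.1.μ t.1.isConjugateSymplectic t.2.1))
      (hLiu t.1.μ t.1.isConjugateSymplectic t.2.1) D ⟨(t.1.ε, t.1.χ), t.2.2⟩⟩

/-- **§2 The Def-4.11 leg `h411C` at `muConj U` WITHOUT Def. 4.11 and WITHOUT the same-`μ` Thm-4.18 family**: irreducible-or-zero (`hirr`) and
smooth (`hsm`) summands of `U` at every admissible index (read at `νᶜ`: the summand of `muConj U` at `(ν, ε, χ)` IS `U`'s at `(νᶜ, ε, χ)`,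
`rfl`, ✔ `conjTriple_mem`), an object `D_ν ∈ 𝒜(ν)` (`hObjC`) and [Liu2021, Thm. 4.18] AS PRINTED at the CONJUGATE rests
`(muConj U).rest (tailC ν hν hw)` (`hLiuC`, the adapter END's displayed family) ⟹ every summand of `(muConj U).prop413Data H` is
irreducible-or-zero, smooth and admissible (✔ `AppendixC.isAdmissibleRep_rhoAt_toThm418Data_of_thm418AsPrinted` at the conjugate rest).
[cite: Liu2021, Def. 4.11 (ll. 2092–2096), Rem. 4.4 (ll. 1912–1933), Thm. 4.18 (ll. 2232–2245), Prop. 4.6 (1) (l. 1969)] -/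
theorem def411_muConj_of_thm418AsPrintedC
    (tail : ∀ (μ : Literature.NumberTheory.Automorphic.IdeleClassGroup E →ₜ* Circle)
      (hμ : letI : IsCMField E := isCMField F E; IdeleClassGroup.IsConjugateSymplectic E μ),
      (letI : IsCMField E := isCMField F E; IdeleClassGroup.HasWeight E μ 1) → RestTail C μ hμ)
    (hirr : ∀ (μ : Literature.NumberTheory.Automorphic.IdeleClassGroup E →ₜ* Circle)
      (hμ : letI : IsCMField E := isCMField F E; IdeleClassGroup.IsConjugateSymplectic E μ)
      (hw : letI : IsCMField E := isCMField F E; IdeleClassGroup.HasWeight E μ 1)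
      (j : (toThm418Data C (U.rest (tail μ hμ hw))).AdmIndex), IsIrreducibleOrZero ((toThm418Data C (U.rest (tail μ hμ hw))).rhoAt j))
    (hsm : ∀ (μ : Literature.NumberTheory.Automorphic.IdeleClassGroup E →ₜ* Circle)
      (hμ : letI : IsCMField E := isCMField F E; IdeleClassGroup.IsConjugateSymplectic E μ)
      (hw : letI : IsCMField E := isCMField F E; IdeleClassGroup.HasWeight E μ 1)
      (j : (toThm418Data C (U.rest (tail μ hμ hw))).AdmIndex), IsSmoothRep ((toThm418Data C (U.rest (tail μ hμ hw))).rhoAt j))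
    (tailC : ∀ (ν : Literature.NumberTheory.Automorphic.IdeleClassGroup E →ₜ* Circle)
      (hν : letI : IsCMField E := isCMField F E; IdeleClassGroup.IsConjugateSymplectic E ν),
      (letI : IsCMField E := isCMField F E; IdeleClassGroup.HasWeight E ν 1) → RestTail C ν hν)
    (hObjC : ∀ (ν : Literature.NumberTheory.Automorphic.IdeleClassGroup E →ₜ* Circle)
      (hν : letI : IsCMField E := isCMField F E; IdeleClassGroup.IsConjugateSymplectic E ν)
      (hw : letI : IsCMField E := isCMField F E; IdeleClassGroup.HasWeight E ν 1),
      Nonempty (toThm418Data C ((muConj U).rest (tailC ν hν hw))).Obj)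
    (hLiuC : ∀ (ν : Literature.NumberTheory.Automorphic.IdeleClassGroup E →ₜ* Circle)
      (hν : letI : IsCMField E := isCMField F E; IdeleClassGroup.IsConjugateSymplectic E ν)
      (hw : letI : IsCMField E := isCMField F E; IdeleClassGroup.HasWeight E ν 1),
      Thm418AsPrinted (toThm418Data C ((muConj U).rest (tailC ν hν hw))))
    (t : ((muConj U).prop413Data H).AdmTriple) :
    IsIrreducibleOrZero (((muConj U).prop413Data H).rhoAt t) ∧ IsSmoothRep (((muConj U).prop413Data H).rhoAt t) ∧
      IsAdmissibleRep (((muConj U).prop413Data H).rhoAt t) := by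
  letI : IsCMField E := isCMField F E
  obtain ⟨D⟩ := hObjC t.1.μ t.1.isConjugateSymplectic t.2.1
  exact ⟨hirr (galConj (IsCMField.complexConj E) t.1.μ) t.1.isConjugateSymplectic.galConj (conjTriple_mem U H t).1
      ⟨(t.1.ε, t.1.χ), (conjTriple_mem U H t).2⟩,
    hsm (galConj (IsCMField.complexConj E) t.1.μ) t.1.isConjugateSymplectic.galConj (conjTriple_mem U H t).1
      ⟨(t.1.ε, t.1.χ), (conjTriple_mem U H t).2⟩,
    AppendixC.isAdmissibleRep_rhoAt_toThm418Data_of_thm418AsPrinted C ((muConj U).rest (tailC t.1.μ t.1.isConjugateSymplectic t.2.1))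
      (hLiuC t.1.μ t.1.isConjugateSymplectic t.2.1) D ⟨(t.1.ε, t.1.χ), t.2.2⟩⟩

end Generic

/-! ## §1b At the model's μ-uniform carriers: the LIVE END's `h411` slot from {hD1, hLiu, h21} -/

section ModelLive

open Literature.AlgebraicGeometry.Motives
open Literature.AlgebraicGeometry.ShimuraVarieties.UnitaryCanonicalModel
open Literature.NumberTheory.Automorphic.Liu2021.AppendixC.RestOne
open Literature.NumberTheory.Automorphic.Liu2021.Def411WeilCarriers (Rep)
open Literature.NumberTheory.GelbartRogawski1991 Literature.NumberTheory.GelbartRogawski1991.UnitaryDualPair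
open Literature.NumberTheory.GelbartRogawski1991.UnitaryDualPair.LocalSplitting (localMu norm_localMu continuous_localMu localMu_toLocalRing_eq_one_iff)
open Literature.NumberTheory.ComplexMultiplication
open Literature.RepresentationTheory.Liu2021
open Summit.HodgeConjecture.CorCM.Model Summit.HodgeConjecture.CorCM.Transposition

/-- **Admissibility at admissible indices from [Liu2021, Thm. 4.18] AS PRINTED at the representative rest** `restOfCharRep … δ′ r μ hμ hw` (the
END's displayed `hLiu'` family, a READING r8) **and `𝒜(μ) ≠ ∅`** (from the displayed `h21` = [Shimura1998, Thm. 21.4], ✔ `nonempty_obj_restOfCharRep`):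
`ω_j` is admissible for every admissible index `j` — ✔ `AppendixC.isAdmissibleRep_rhoAt_toThm418Data_of_thm418AsPrinted` (Thm. 4.18 main clause +
item (1) + [Mumford §19 Thm. 3] = tree theorem `AbelianVariety.module_finite_hom_holds`).  Nothing of [Liu2021] is asserted: `hLiu`, `h21` are hypotheses.
[cite: Liu2021, Thm. 4.18 (main clause l. 2233–2237 and (1) l. 2239), Def. 4.11 (l. 2092–2096), Prop. 4.6 (1) (l. 1969)] [cite: Shimura1998, §21.4 Thm. 21.4] -/
theorem _root_.Summit.HodgeConjecture.CorCM.Model.isAdmissibleRep_rhoAt_restOfCharRep_of_thm418AsPrinted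
    (h : exists_recordSystem) (F : CMField) [IsGalois ℚ F] (h6 : 6 ≤ Module.finrank ℚ F)
    (ι₁ : F →+* ℂ) (V : HermSpace3 F ι₁) (Φ : CMType F) {n : ℕ} (e : Fin 3 × Fin 1 ≃ Fin n) (dV : Fin 3 → F)
    (hdV : ∀ i, IsCMField.complexConj F (dV i) = dV i) (hdV0 : ∀ i, dV i ≠ 0)
    (ιV : (sec42DataOf h isoOf F ι₁ V Φ).G →*
      UnitaryGroup.finAdelic ↥(maximalRealSubfield F) F (IsCMField.complexConj F) 3 (Matrix.diagonal dV))
    (δ' : F) (r : Rep ↥(maximalRealSubfield F) (imagUnitSq F))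
    (μ : Literature.NumberTheory.Automorphic.IdeleClassGroup F →ₜ* Circle) (hμ : IdeleClassGroup.IsConjugateSymplectic F μ)
    (hw : IdeleClassGroup.HasWeight F μ 1) (h21 : shimura1998_thm21_4_casselman)
    (hLiu : Thm418AsPrinted (toThm418Data (sec42DataOf h isoOf F ι₁ V Φ) (restOfCharRep h F h6 ι₁ V Φ e dV hdV hdV0 ιV δ' r μ hμ hw)))
    (j : (toThm418Data (sec42DataOf h isoOf F ι₁ V Φ) (restOfCharRep h F h6 ι₁ V Φ e dV hdV hdV0 ιV δ' r μ hμ hw)).AdmIndex) :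
    IsAdmissibleRep ((toThm418Data (sec42DataOf h isoOf F ι₁ V Φ) (restOfCharRep h F h6 ι₁ V Φ e dV hdV hdV0 ιV δ' r μ hμ hw)).rhoAt j) := by
  obtain ⟨Dμ⟩ := nonempty_obj_restOfCharRep h F h6 ι₁ V Φ e dV hdV hdV0 ιV δ' r μ hμ hw h21
  exact AppendixC.isAdmissibleRep_rhoAt_toThm418Data_of_thm418AsPrinted _ _ hLiu Dμ j

set_option maxHeartbeats 2000000 in
-- (the `restTailOne` tails carry the `splittingDatum` telescope of `restOfCharRep`, as in ✔ `Item6UniformOmegaRep.restOfCharRep_eq_rest`)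
/-- **h411 FROM THE DISPLAYED CITATIONS ALONE — the LIVE END's `h411` slot from {`hD1`, `hLiu`, `h21`}.**  For `U := Model.uniformOmegaRep … δ′ r`,
`ιV` continuous and onto and `3 ≤ n`: GIVEN, for every conjugate-symplectic weight-one `μ` and every admissible index of the rest
`restOfCharRep … δ′ (r μ hμ) μ hμ hw`, [Liu2021, App. D Lem. D.1, first sentence + (1)] AS PRINTED per place (`hD1`), [Liu2021, Thm. 4.18] AS PRINTED at
these rests (`hLiu`, the END's `hLiu'` family) and [Shimura1998, Thm. 21.4] (`h21`), every summand `ω_t` of `U.prop413Data H` is irreducible-or-zero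
(✔ `rhoAt_restOfCharRep_isIrreducible_of_lemD1AsPrinted`), smooth (✔ `rhoAt_restOfCharRep_smooth`) and admissible (§1b above) — the `h411` binder of
✔ `PinSignatures.thm418C_liuDictionaryPin_of_pins`, with NO conjunct of [Liu2021, Def. 4.11] posited.  Nothing of [Liu2021] ∕ [Shimura1998] is asserted.
[cite: Liu2021, Def. 4.11 (FJcycle.tex ll. 2083–2097), Thm. 4.18 (ll. 2232–2245), App. D Lemma D.1 (l. 5227; (1) l. 5229)]
[cite: Shimura1998, §21.4 Thm. 21.4] [cite: GelbartRogawski1991, §3.1 Prop. 3.1.1 p. 455 L1–3] -/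
theorem _root_.Summit.HodgeConjecture.CorCM.Model.adjectives_rhoAt_uniformOmegaRep_of_lemD1AsPrinted_of_thm418AsPrinted
    (h : exists_recordSystem) (F : CMField) [IsGalois ℚ F] (h6 : 6 ≤ Module.finrank ℚ F)
    (ι₁ : F →+* ℂ) (V : HermSpace3 F ι₁) (Φ : CMType F) {n : ℕ} (e : Fin 3 × Fin 1 ≃ Fin n) (dV : Fin 3 → F)
    (hdV : ∀ i, IsCMField.complexConj F (dV i) = dV i) (hdV0 : ∀ i, dV i ≠ 0)
    (ιV : (sec42DataOf h isoOf F ι₁ V Φ).G →*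
      UnitaryGroup.finAdelic ↥(maximalRealSubfield F) F (IsCMField.complexConj F) 3 (Matrix.diagonal dV))
    (δ' : F) (r : ∀ μ : Literature.NumberTheory.Automorphic.IdeleClassGroup F →ₜ* Circle,
      IdeleClassGroup.IsConjugateSymplectic F μ → Rep ↥(maximalRealSubfield F) (imagUnitSq F))
    (H : Type) [AddCommGroup H] [Module ℂ H] [Module (MonoidAlgebra ℂ (sec42DataOf h isoOf F ι₁ V Φ).G) H]
    [IsScalarTower ℂ (MonoidAlgebra ℂ (sec42DataOf h isoOf F ι₁ V Φ).G) H]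
    (hιc : Continuous ιV) (hιs : Function.Surjective ιV) (hn : 3 ≤ n) (h21 : shimura1998_thm21_4_casselman)
    (hD1 : ∀ (μ : Literature.NumberTheory.Automorphic.IdeleClassGroup F →ₜ* Circle) (hμ : IdeleClassGroup.IsConjugateSymplectic F μ)
      (hw : IdeleClassGroup.HasWeight F μ 1)
      (j : (toThm418Data (sec42DataOf h isoOf F ι₁ V Φ) (restOfCharRep h F h6 ι₁ V Φ e dV hdV hdV0 ιV δ' (r μ hμ) μ hμ hw)).AdmIndex)
      (v : HeightOneSpectrum (𝓞 ↥(maximalRealSubfield F))), LemD1_1AsPrinted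
      (Def411WeilCarriers.localLemD1Data ↥(maximalRealSubfield F) F (IsCMField.complexConj F) 3 e (Matrix.diagonal dV)
        (complexConj_imagUnit F) (imagUnit_ne_zero F) (imagUnit_mul_self F) (realDiagonal_isSymm F dV hdV)
        (isUnit_det_realDiagonal F dV hdV hdV0) (realDiagonal_map F dV hdV).symm ((r μ hμ).toFun j.1.1)
        (OmegaChiSplitting.chiLocalSplittingsD F e dV hdV hdV0 (toHeckeCharacter F μ) ((isOscillatorChar_toHeckeCharacter_iff μ).mpr hμ)
          ((r μ hμ).toFun j.1.1))
        hn (localMu F (toHeckeCharacter F μ))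
        (fun v x => norm_localMu F (toHeckeCharacter F μ) v (isUnitary_toHeckeCharacter F μ) x)
        (continuous_localMu F (toHeckeCharacter F μ))
        (fun v t => localMu_toLocalRing_eq_one_iff F (toHeckeCharacter F μ) v ((isOscillatorChar_toHeckeCharacter_iff μ).mpr hμ) t)
        j.1.2.1
        (Def411WeilCarriers.norm_chi_eq_one ↥(maximalRealSubfield F) F (IsCMField.complexConj F)
          (Algebra.IsQuadraticExtension.finrank_eq_two ↥(maximalRealSubfield F) F)
          (UnitaryGroup.algEquiv_ne_one_of_apply_eq_neg ↥(maximalRealSubfield F) F (IsCMField.complexConj F) (complexConj_imagUnit F)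
            (imagUnit_ne_zero F)) j.1.2)
        j.1.2.2.1 v))
    (hLiu : ∀ (μ : Literature.NumberTheory.Automorphic.IdeleClassGroup F →ₜ* Circle) (hμ : IdeleClassGroup.IsConjugateSymplectic F μ)
      (hw : IdeleClassGroup.HasWeight F μ 1),
      Thm418AsPrinted (toThm418Data (sec42DataOf h isoOf F ι₁ V Φ) (restOfCharRep h F h6 ι₁ V Φ e dV hdV hdV0 ιV δ' (r μ hμ) μ hμ hw)))
    (t : ((uniformOmegaRep h F ι₁ V Φ e dV hdV hdV0 ιV δ' r).prop413Data H).AdmTriple) :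
    IsIrreducibleOrZero (((uniformOmegaRep h F ι₁ V Φ e dV hdV hdV0 ιV δ' r).prop413Data H).rhoAt t) ∧
      IsSmoothRep (((uniformOmegaRep h F ι₁ V Φ e dV hdV hdV0 ιV δ' r).prop413Data H).rhoAt t) ∧
      IsAdmissibleRep (((uniformOmegaRep h F ι₁ V Φ e dV hdV hdV0 ιV δ' r).prop413Data H).rhoAt t) :=
  def411_of_thm418AsPrinted (uniformOmegaRep h F ι₁ V Φ e dV hdV hdV0 ιV δ' r) H
    (fun μ hμ hw => restTailOne (AlgHom.id ℚ F) ι₁ hμ hw (Def45.Carriers.ofPolDR μ (Def45.PolDR ι₁ hμ (Def45.RMuForm ι₁ hμ)))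
      ((heckeTranslatesFamilyOf heckeTranslate_definedOver_holds h isoOf F ι₁ V Φ h6).rhoΩOne (AlgHom.id ℚ F) ι₁ hμ hw
        (Def45.Carriers.ofPolDR μ (Def45.PolDR ι₁ hμ (Def45.RMuForm ι₁ hμ)))))
    (fun μ hμ hw j => isIrreducibleOrZero_of_isIrreducible
      (rhoAt_restOfCharRep_isIrreducible_of_lemD1AsPrinted h F h6 ι₁ V Φ e dV hdV hdV0 ιV δ' (r μ hμ) μ hμ hw hιs hn j (hD1 μ hμ hw j)))
    (fun μ hμ hw j v => rhoAt_restOfCharRep_smooth h F h6 ι₁ V Φ e dV hdV hdV0 ιV δ' (r μ hμ) μ hμ hw hιc j v)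
    (fun μ hμ hw => nonempty_obj_restOfCharRep h F h6 ι₁ V Φ e dV hdV hdV0 ιV δ' (r μ hμ) μ hμ hw h21)
    hLiu t

end ModelLive

/-! ## §3 At the model's μ-uniform carriers `Model.uniformOmegaRep … δ′ r` -/

section Model

open Literature.AlgebraicGeometry.Motives
open Literature.AlgebraicGeometry.ShimuraVarieties.UnitaryCanonicalModel
open Literature.NumberTheory.Automorphic.Liu2021.AppendixC.RestOne
open Literature.NumberTheory.Automorphic.Liu2021.Def411WeilCarriers (Rep)
open Literature.NumberTheory.GelbartRogawski1991 Literature.NumberTheory.GelbartRogawski1991.UnitaryDualPair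
open Literature.NumberTheory.GelbartRogawski1991.UnitaryDualPair.LocalSplitting (localMu norm_localMu continuous_localMu localMu_toLocalRing_eq_one_iff)
open Literature.NumberTheory.ComplexMultiplication
open Literature.RepresentationTheory.Liu2021
open Summit.HodgeConjecture.CorCM.Model Summit.HodgeConjecture.CorCM.Transposition

set_option maxHeartbeats 2000000 in
-- (the `restTailOne` tails carry the `splittingDatum` telescope of `restOfCharRep`, as in ✔ `Item6UniformOmegaRep.restOfCharRep_eq_rest`)
/-- **§3 The adapter's `h411C` at the model WITHOUT `h411`**: for `U := Model.uniformOmegaRep h F ι₁ V Φ e dV hdV hdV0 ιV δ′ r` (`ιV` continuous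
and onto, `3 ≤ n`) with the one-object tails `restTailOne …` at `μ` (for `U`) and at `ν` (for `muConj U`): binders `hD1` = [Liu2021, App. D Lem. D.1,
first sentence + (1)] AS PRINTED per place at the `μ`-attached local data on the line `⟨r μ hμ ε⟩`, EVERY `μ` (irreducible: ✔
`rhoAt_restOfCharRep_isIrreducible_of_lemD1AsPrinted`; smooth is ✔ `rhoAt_restOfCharRep_smooth`), `hLiuC` = [Liu2021, Thm. 4.18] AS PRINTED at the
conjugate rests `(muConj U).rest (restTailOne … ν …)`, `h21` = [Shimura1998, Thm. 21.4] (`𝒜(ν) ≠ ∅`, ✔ `nonempty_obj_restOfCharRep`) ⟹ the Def-4.11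
leg at `muConj U`.  Nothing of [Liu2021] ∕ [Shimura1998] is asserted.
[cite: Liu2021, Def. 4.11 (ll. 2092–2096), Rem. 4.4, Thm. 4.18 (ll. 2232–2245), App. D Lem. D.1 (l. 5227; (1) l. 5229)] [cite: Shimura1998, §21.4 Thm. 21.4] -/
theorem def411_muConj_uniformOmegaRep_of_lemD1AsPrinted_of_thm418AsPrintedC
    (h : exists_recordSystem) (F : CMField) [IsGalois ℚ F] (h6 : 6 ≤ Module.finrank ℚ F)
    (ι₁ : F →+* ℂ) (V : HermSpace3 F ι₁) (Φ : CMType F) {n : ℕ} (e : Fin 3 × Fin 1 ≃ Fin n) (dV : Fin 3 → F)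
    (hdV : ∀ i, IsCMField.complexConj F (dV i) = dV i) (hdV0 : ∀ i, dV i ≠ 0)
    (ιV : (sec42DataOf h isoOf F ι₁ V Φ).G →*
      UnitaryGroup.finAdelic ↥(maximalRealSubfield F) F (IsCMField.complexConj F) 3 (Matrix.diagonal dV))
    (δ' : F) (r : ∀ μ : Literature.NumberTheory.Automorphic.IdeleClassGroup F →ₜ* Circle,
      IdeleClassGroup.IsConjugateSymplectic F μ → Rep ↥(maximalRealSubfield F) (imagUnitSq F))
    (H : Type) [AddCommGroup H] [Module ℂ H] [Module (MonoidAlgebra ℂ (sec42DataOf h isoOf F ι₁ V Φ).G) H]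
    [IsScalarTower ℂ (MonoidAlgebra ℂ (sec42DataOf h isoOf F ι₁ V Φ).G) H]
    (hιc : Continuous ιV) (hιs : Function.Surjective ιV) (hn : 3 ≤ n) (h21 : shimura1998_thm21_4_casselman)
    (hD1 : ∀ (μ : Literature.NumberTheory.Automorphic.IdeleClassGroup F →ₜ* Circle) (hμ : IdeleClassGroup.IsConjugateSymplectic F μ)
      (hw : IdeleClassGroup.HasWeight F μ 1)
      (j : (toThm418Data (sec42DataOf h isoOf F ι₁ V Φ) (restOfCharRep h F h6 ι₁ V Φ e dV hdV hdV0 ιV δ' (r μ hμ) μ hμ hw)).AdmIndex)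
      (v : HeightOneSpectrum (𝓞 ↥(maximalRealSubfield F))), LemD1_1AsPrinted
      (Def411WeilCarriers.localLemD1Data ↥(maximalRealSubfield F) F (IsCMField.complexConj F) 3 e (Matrix.diagonal dV)
        (complexConj_imagUnit F) (imagUnit_ne_zero F) (imagUnit_mul_self F) (realDiagonal_isSymm F dV hdV)
        (isUnit_det_realDiagonal F dV hdV hdV0) (realDiagonal_map F dV hdV).symm ((r μ hμ).toFun j.1.1)
        (OmegaChiSplitting.chiLocalSplittingsD F e dV hdV hdV0 (toHeckeCharacter F μ) ((isOscillatorChar_toHeckeCharacter_iff μ).mpr hμ)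
          ((r μ hμ).toFun j.1.1))
        hn (localMu F (toHeckeCharacter F μ))
        (fun v x => norm_localMu F (toHeckeCharacter F μ) v (isUnitary_toHeckeCharacter F μ) x)
        (continuous_localMu F (toHeckeCharacter F μ))
        (fun v t => localMu_toLocalRing_eq_one_iff F (toHeckeCharacter F μ) v ((isOscillatorChar_toHeckeCharacter_iff μ).mpr hμ) t)
        j.1.2.1
        (Def411WeilCarriers.norm_chi_eq_one ↥(maximalRealSubfield F) F (IsCMField.complexConj F)
          (Algebra.IsQuadraticExtension.finrank_eq_two ↥(maximalRealSubfield F) F)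
          (UnitaryGroup.algEquiv_ne_one_of_apply_eq_neg ↥(maximalRealSubfield F) F (IsCMField.complexConj F) (complexConj_imagUnit F)
            (imagUnit_ne_zero F)) j.1.2)
        j.1.2.2.1 v))
    (hLiuC : ∀ (ν : Literature.NumberTheory.Automorphic.IdeleClassGroup F →ₜ* Circle) (hν : IdeleClassGroup.IsConjugateSymplectic F ν)
      (hw : IdeleClassGroup.HasWeight F ν 1),
      Thm418AsPrinted (toThm418Data (sec42DataOf h isoOf F ι₁ V Φ) ((muConj (uniformOmegaRep h F ι₁ V Φ e dV hdV hdV0 ιV δ' r)).rest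
        (restTailOne (AlgHom.id ℚ F) ι₁ hν hw (Def45.Carriers.ofPolDR ν (Def45.PolDR ι₁ hν (Def45.RMuForm ι₁ hν)))
          ((heckeTranslatesFamilyOf heckeTranslate_definedOver_holds h isoOf F ι₁ V Φ h6).rhoΩOne (AlgHom.id ℚ F) ι₁ hν hw
            (Def45.Carriers.ofPolDR ν (Def45.PolDR ι₁ hν (Def45.RMuForm ι₁ hν))))))))
    (t : ((muConj (uniformOmegaRep h F ι₁ V Φ e dV hdV hdV0 ιV δ' r)).prop413Data H).AdmTriple) :
    IsIrreducibleOrZero (((muConj (uniformOmegaRep h F ι₁ V Φ e dV hdV hdV0 ιV δ' r)).prop413Data H).rhoAt t) ∧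
      IsSmoothRep (((muConj (uniformOmegaRep h F ι₁ V Φ e dV hdV hdV0 ιV δ' r)).prop413Data H).rhoAt t) ∧
      IsAdmissibleRep (((muConj (uniformOmegaRep h F ι₁ V Φ e dV hdV hdV0 ιV δ' r)).prop413Data H).rhoAt t) :=
  def411_muConj_of_thm418AsPrintedC (uniformOmegaRep h F ι₁ V Φ e dV hdV hdV0 ιV δ' r) H
    (fun μ hμ hw => restTailOne (AlgHom.id ℚ F) ι₁ hμ hw (Def45.Carriers.ofPolDR μ (Def45.PolDR ι₁ hμ (Def45.RMuForm ι₁ hμ)))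
      ((heckeTranslatesFamilyOf heckeTranslate_definedOver_holds h isoOf F ι₁ V Φ h6).rhoΩOne (AlgHom.id ℚ F) ι₁ hμ hw
        (Def45.Carriers.ofPolDR μ (Def45.PolDR ι₁ hμ (Def45.RMuForm ι₁ hμ)))))
    (fun μ hμ hw j => isIrreducibleOrZero_of_isIrreducible
      (rhoAt_restOfCharRep_isIrreducible_of_lemD1AsPrinted h F h6 ι₁ V Φ e dV hdV hdV0 ιV δ' (r μ hμ) μ hμ hw hιs hn j (hD1 μ hμ hw j)))
    (fun μ hμ hw j v => rhoAt_restOfCharRep_smooth h F h6 ι₁ V Φ e dV hdV hdV0 ιV δ' (r μ hμ) μ hμ hw hιc j v)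
    (fun ν hν hw => restTailOne (AlgHom.id ℚ F) ι₁ hν hw (Def45.Carriers.ofPolDR ν (Def45.PolDR ι₁ hν (Def45.RMuForm ι₁ hν)))
      ((heckeTranslatesFamilyOf heckeTranslate_definedOver_holds h isoOf F ι₁ V Φ h6).rhoΩOne (AlgHom.id ℚ F) ι₁ hν hw
        (Def45.Carriers.ofPolDR ν (Def45.PolDR ι₁ hν (Def45.RMuForm ι₁ hν)))))
    (fun ν hν hw => nonempty_obj_restOfCharRep h F h6 ι₁ V Φ e dV hdV hdV0 ιV δ' (r ν hν) ν hν hw h21)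
    hLiuC t

end Model

end Summit.HodgeConjecture.CorCM.D2Bridge.AdapterMuConj

end
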